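import Literature.MathematicalPhysics.QuantumFieldTheory.Balaban1983to89.B3WTPropagator

/-!
# `Balaban1983to89.B3WTCovariance` — T. Bałaban, *(Higgs)₂,₃ quantum fields in a finite volume. III. Renormalization*,
# Commun. Math. Phys. **88** (1983) 411–445 [Balaban1983Higgs3], (2.25)/(2.26) p. 431: Gaussian integration by parts and the
# second moments `∫dμ_{C^η_{M²}}φ_i(x)φ_k(y) = δ_{ik}C^η_{M²}(x,y)` ON THE CONCRETE LATTICE MODEL (file 2/2)

statement-level skeleton of published theorems with citation tags; proofs where landed; nothing here is a claim about the Yang–Mills mass gap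

Page 431 [PDF 21] (image render `run/shared/lean/pub/pub-balaban/b2b-balaban-ref1/pages/1983-cmp88-higgs23-III/…-p021-x2.png`):
*"… calculating the Gaussian integrals … where now the propagators are C^η_{M²}"*.  THIS FILE proves, for the lattice model of
`…B3WT223Instance` with the propagator `C^η_{M²} = B3WTPropagator.G`:
* `gaussIBP` — **Gaussian integration by parts** `∫dφ e^{−½⟨φ,Kφ⟩}⟨φ,Kh⟩g(φ) = ∫dφ e^{−½⟨φ,Kφ⟩}(D_hg)(φ)`, `K = η^d(−Δ^η+M²)`,
  PROVED from the translation invariance of `dφ` (`MeasureTheory.integral_add_right_eq_self`) by differentiating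
  `s ↦ ∫e^{−½⟨φ+sh,K(φ+sh)⟩}g(φ+sh)dφ` at `s = 0` under the integral sign (dominated convergence, majorant of
  `B3WT224Instance.integrable_explin_mul_gauss`) and `B3Sect2StatementsPart2.deriv_eq_zero_of_invariant` BY NAME;
* `moment2` — **the covariance**: `∫dφ e^{−½⟨φ,Kφ⟩}⟪φ(x),v⟫⟪φ(y),u⟫ = Z·C^η_{M²}(x,y)⟪v,u⟫` (direction `h = C(·,x)⊗v`,
  `⟨φ,Kh⟩ = ⟪φ(x),v⟫` by `B3WTPropagator.Kbil_gcol`), and the operator form `moment2_op`: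
  `∫dφ e^{−½⟨φ,Kφ⟩}⟪φ(x),Qφ(y)⟫ = Z·C^η_{M²}(x,y)·tr Q` (`trE Q = Σ_i⟪e_i,Qe_i⟫`; e.g. `Q = q²` in (2.26)).
* `G_transl`/`G_diag` — **translation invariance of the propagator** on the torus, `C(x+t,y+t) = C(x,y)`, hence
  `C(x,x) = C^η_{M²}(0)` (`C0`), the constant of the third term of (2.26) (from the translation invariance of `⟨a,(−Δ^η+M²)a'⟩`,
  `sform_transl`, and `Matrix.inv_submatrix_equiv`).
(The scalar-carrier analogue `∫e^{−½⟨v,Kv⟩}v_iv_j dv = Z·(K⁻¹)_{ij}` on `ι → ℝ` is r06's `B9Eq3125Moment.integral_gaussian_mul_mul`;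
the route here is integration by parts, which also yields the fourth moments of the sequel `…B3WTWick`.)  Phase-2 RESERVE R11
(part 2b) of `PHASE2-TARGETS.md` §G.3; cell `lit-balaban`, seat p39 (gen 2, unit `lit-balaban-p39`), HOME
`run/shared/lean/pub/lit-balaban/`.  Nothing beyond these lattice identities is asserted; no new `Prop` is introduced.
-/

noncomputable section

open scoped BigOperators InnerProductSpace

namespace Literature.MathematicalPhysics.QuantumFieldTheory.Balaban1983to89.B3WTCovariance

open _root_.MeasureTheory Matrix
open LatticeFieldCalculus B3WT223Instance B3WT224Instance B3WTPropagator

variable {P : Params} {j N : ℕ} (C : HiggsLattice.ChargeData N) (η w c M2 : ℝ)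

/-! ## §4 Gaussian integration by parts -/

/-- **Gaussian integration by parts on field space**: `∫dφ e^{−½⟨φ,Kφ⟩}⟨φ,Kh⟩g(φ) = ∫dφ e^{−½⟨φ,Kφ⟩}(D_hg)(φ)`,
`K = η^d(−Δ^η+M²)`, for every direction `h` and every continuous `g` differentiable along `h` (`D_hg = g'`) with `g`, `g'` of
exponential-linear growth.  Proof: `s ↦ ∫e^{−½⟨φ+sh,K(φ+sh)⟩}g(φ+sh)dφ` is constant (translation invariance of `dφ`,
`MeasureTheory.integral_add_right_eq_self`), differentiable at `0` under the integral sign, and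
`B3Sect2StatementsPart2.deriv_eq_zero_of_invariant` BY NAME. [cite: Balaban1983Higgs3, (2.26) p.431] -/
theorem gaussIBP (hw : 0 < w) (hM : 0 < M2) (h : Cfg P j N) (g g' : Cfg P j N → ℝ)
    (hg : ∀ (φ : Cfg P j N) (s : ℝ), HasDerivAt (fun s : ℝ => g (φ + s • h)) (g' (φ + s • h)) s)
    (hgc : Continuous g) (hg'c : Continuous g') {K κ : ℝ} (hκ : 0 ≤ κ)
    (hgb : ∀ φ, |g φ| ≤ K * Real.exp (κ * ‖φ‖)) (hg'b : ∀ φ, |g' φ| ≤ K * Real.exp (κ * ‖φ‖)) :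
    ∫ φ, weight C η w c M2 (0 : VecField P j ℝ) φ * (Kbil w c M2 φ h * g φ) =
      ∫ φ, weight C η w c M2 (0 : VecField P j ℝ) φ * g' φ := by
  have hK : 0 ≤ K := by
    by_contra hK
    have h0 := hgb 0
    have : K * Real.exp (κ * ‖(0 : Cfg P j N)‖) < 0 := mul_neg_of_neg_of_pos (not_le.mp hK) (Real.exp_pos _)
    linarith [abs_nonneg (g 0)]
  set W : Cfg P j N → ℝ := weight C η w c M2 (0 : VecField P j ℝ) with hWdef
  -- the family `F s = e^{−½⟨φ+sh,K(φ+sh)⟩}g(φ+sh)` and its `s`-derivative `F'`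
  set F : ℝ → Cfg P j N → ℝ := fun s φ => W (φ + s • h) * g (φ + s • h) with hF
  set F' : ℝ → Cfg P j N → ℝ := fun s φ =>
    -(Kbil w c M2 (φ + s • h) h) * W (φ + s • h) * g (φ + s • h) + W (φ + s • h) * g' (φ + s • h) with hF'
  -- translation invariance: the family of integrals is constant
  have hconst : ∀ s : ℝ, ∫ φ, F s φ = ∫ φ, F 0 φ := fun s => by
    simp only [hF, zero_smul, add_zero]
    exact integral_add_right_eq_self (μ := (volume : Measure (Cfg P j N))) (fun φ => W φ * g φ) (s • h)
  -- majorant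
  set a : ℝ := M2 * w / 4 with ha_def
  have ha : 0 < a := by positivity
  set S : ℝ := Real.exp (M2 * w / 2 * ∑ x : Site P j, ‖h x‖ ^ 2) with hS
  set Mc : ℝ := (kbound w c M2 h * (1 + ‖h‖) + 1) * (S * (K * Real.exp (κ * ‖h‖))) with hMc
  set bound : Cfg P j N → ℝ := fun φ => Mc * (Real.exp ((κ + 1) * ‖φ‖) * Real.exp (-a * ∑ x : Site P j, ‖φ x‖ ^ 2))
    with hbound
  have hbound_int : Integrable bound := (integrable_explin_mul_gauss (P := P) (j := j) (N := N) (κ + 1) ha).const_mul Mc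
  have hkb := kbound_nonneg w c M2 h
  have h_bound : ∀ᵐ φ ∂(volume : Measure (Cfg P j N)), ∀ s ∈ Metric.ball (0 : ℝ) 1, ‖F' s φ‖ ≤ bound φ := by
    refine Filter.Eventually.of_forall fun φ s hs => ?_
    have hs1 : |s| ≤ 1 := by
      rw [Metric.mem_ball, dist_zero_right, Real.norm_eq_abs] at hs
      exact hs.le
    set ψ := φ + s • h with hψ
    have hWpos : 0 < W ψ := weight_pos (C := C) (η := η) (w := w) (c := c) (M2 := M2) _ ψ
    have hWle : W ψ ≤ S * Real.exp (-a * ∑ x : Site P j, ‖φ x‖ ^ 2) := weight_transl_le C η w c M2 hw.le hM.le φ h hs1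
    have hψn : ‖ψ‖ ≤ ‖φ‖ + ‖h‖ := by
      refine (norm_add_le _ _).trans (add_le_add le_rfl ?_)
      rw [norm_smul, Real.norm_eq_abs]
      have := mul_le_mul_of_nonneg_right hs1 (norm_nonneg h)
      rwa [one_mul] at this
    have hexpφ : ‖φ‖ + ‖h‖ ≤ (1 + ‖h‖) * Real.exp ‖φ‖ := by
      have h1 : ‖φ‖ ≤ Real.exp ‖φ‖ := by linarith [Real.add_one_le_exp ‖φ‖]
      have h2 : 1 ≤ Real.exp ‖φ‖ := Real.one_le_exp (norm_nonneg _)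
      nlinarith [norm_nonneg h]
    have hgrow : Real.exp (κ * ‖ψ‖) ≤ Real.exp (κ * ‖h‖) * Real.exp (κ * ‖φ‖) := by
      rw [← Real.exp_add, Real.exp_le_exp]
      nlinarith
    have hgψ : |g ψ| ≤ K * Real.exp (κ * ‖h‖) * Real.exp (κ * ‖φ‖) :=
      (hgb ψ).trans (by rw [mul_assoc]; exact mul_le_mul_of_nonneg_left hgrow hK)
    have hg'ψ : |g' ψ| ≤ K * Real.exp (κ * ‖h‖) * Real.exp (κ * ‖φ‖) :=
      (hg'b ψ).trans (by rw [mul_assoc]; exact mul_le_mul_of_nonneg_left hgrow hK)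
    have hKb : |Kbil w c M2 ψ h| ≤ kbound w c M2 h * ((1 + ‖h‖) * Real.exp ‖φ‖) :=
      (abs_Kbil_le w c M2 ψ h).trans (mul_le_mul_of_nonneg_left (hψn.trans hexpφ) hkb)
    have e1 : ‖F' s φ‖ ≤ |Kbil w c M2 ψ h| * W ψ * |g ψ| + W ψ * |g' ψ| := by
      simp only [hF', Real.norm_eq_abs]
      refine (abs_add_le _ _).trans (le_of_eq ?_)
      rw [abs_mul, abs_mul, abs_mul, abs_neg, abs_of_pos hWpos]
    refine e1.trans ?_
    have E := Real.exp (-a * ∑ x : Site P j, ‖φ x‖ ^ 2)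
    have t1 : |Kbil w c M2 ψ h| * W ψ * |g ψ| ≤ (kbound w c M2 h * ((1 + ‖h‖) * Real.exp ‖φ‖)) *
        (S * Real.exp (-a * ∑ x : Site P j, ‖φ x‖ ^ 2)) * (K * Real.exp (κ * ‖h‖) * Real.exp (κ * ‖φ‖)) :=
      mul_le_mul (mul_le_mul hKb hWle hWpos.le (by positivity)) hgψ (abs_nonneg _) (by positivity)
    have t2 : W ψ * |g' ψ| ≤ (S * Real.exp (-a * ∑ x : Site P j, ‖φ x‖ ^ 2)) * (K * Real.exp (κ * ‖h‖) * Real.exp (κ * ‖φ‖)) :=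
      mul_le_mul hWle hg'ψ (abs_nonneg _) (by positivity)
    refine (add_le_add t1 t2).trans ?_
    have hex : Real.exp ‖φ‖ * Real.exp (κ * ‖φ‖) = Real.exp ((κ + 1) * ‖φ‖) := by
      rw [← Real.exp_add]
      ring_nf
    have hex1 : Real.exp (κ * ‖φ‖) ≤ Real.exp ((κ + 1) * ‖φ‖) :=
      Real.exp_le_exp.mpr (by nlinarith [norm_nonneg φ])
    simp only [hbound, hMc]
    have hSK : 0 ≤ S * (K * Real.exp (κ * ‖h‖)) * Real.exp (-a * ∑ x : Site P j, ‖φ x‖ ^ 2) := by positivity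
    calc kbound w c M2 h * ((1 + ‖h‖) * Real.exp ‖φ‖) * (S * Real.exp (-a * ∑ x : Site P j, ‖φ x‖ ^ 2)) *
          (K * Real.exp (κ * ‖h‖) * Real.exp (κ * ‖φ‖))
          + S * Real.exp (-a * ∑ x : Site P j, ‖φ x‖ ^ 2) * (K * Real.exp (κ * ‖h‖) * Real.exp (κ * ‖φ‖))
        = kbound w c M2 h * (1 + ‖h‖) * (S * (K * Real.exp (κ * ‖h‖)) * Real.exp (-a * ∑ x : Site P j, ‖φ x‖ ^ 2)) *
            (Real.exp ‖φ‖ * Real.exp (κ * ‖φ‖))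
          + (S * (K * Real.exp (κ * ‖h‖)) * Real.exp (-a * ∑ x : Site P j, ‖φ x‖ ^ 2)) * Real.exp (κ * ‖φ‖) := by ring
      _ ≤ kbound w c M2 h * (1 + ‖h‖) * (S * (K * Real.exp (κ * ‖h‖)) * Real.exp (-a * ∑ x : Site P j, ‖φ x‖ ^ 2)) *
            Real.exp ((κ + 1) * ‖φ‖)
          + (S * (K * Real.exp (κ * ‖h‖)) * Real.exp (-a * ∑ x : Site P j, ‖φ x‖ ^ 2)) * Real.exp ((κ + 1) * ‖φ‖) := by
          rw [hex]
          exact add_le_add le_rfl (mul_le_mul_of_nonneg_left hex1 hSK)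
      _ = (kbound w c M2 h * (1 + ‖h‖) + 1) * (S * (K * Real.exp (κ * ‖h‖))) *
            (Real.exp ((κ + 1) * ‖φ‖) * Real.exp (-a * ∑ x : Site P j, ‖φ x‖ ^ 2)) := by ring
  have h_diff : ∀ᵐ φ ∂(volume : Measure (Cfg P j N)), ∀ s ∈ Metric.ball (0 : ℝ) 1, HasDerivAt (F · φ) (F' s φ) s := by
    refine Filter.Eventually.of_forall fun φ s _ => ?_
    simp only [hF, hF']
    exact (hasDerivAt_weight_transl C η w c M2 φ h s).mul (hg φ s)
  have hshift : ∀ s : ℝ, Continuous fun φ : Cfg P j N => φ + s • h := fun s => continuous_id.add continuous_const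
  have hF_meas : ∀ s : ℝ, AEStronglyMeasurable (F s) (volume : Measure (Cfg P j N)) := fun s =>
    (((continuous_weight C η w c M2 _).comp (hshift s)).mul (hgc.comp (hshift s))).aestronglyMeasurable
  have hF'_meas : AEStronglyMeasurable (F' 0) (volume : Measure (Cfg P j N)) :=
    ((((continuous_Kbil_left w c M2 h).comp (hshift 0)).neg.mul ((continuous_weight C η w c M2 _).comp (hshift 0))).mul
      (hgc.comp (hshift 0))).add (((continuous_weight C η w c M2 _).comp (hshift 0)).mul (hg'c.comp (hshift 0))) |>.aestronglyMeasurable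
  have hF_int : Integrable (F 0) (volume : Measure (Cfg P j N)) := by
    have : F 0 = fun φ => W φ * g φ := by
      funext φ
      simp only [hF, zero_smul, add_zero]
    rw [this]
    exact integrable_weight_mul C η w c M2 hw hM hgc hgb
  -- differentiation under the integral sign; the derivative of the constant family vanishes
  have hD := (hasDerivAt_integral_of_dominated_loc_of_deriv_le (Metric.ball_mem_nhds (0 : ℝ) one_pos)
    (Filter.Eventually.of_forall hF_meas) hF_int hF'_meas h_bound hbound_int h_diff).2
  have hzero := B3Sect2StatementsPart2.deriv_eq_zero_of_invariant hconst hD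
  -- split the vanishing integral
  have hI1 : Integrable (fun φ => W φ * (Kbil w c M2 φ h * g φ)) (volume : Measure (Cfg P j N)) := by
    refine integrable_weight_mul C η w c M2 hw hM ((continuous_Kbil_left w c M2 h).mul hgc)
      (K := kbound w c M2 h * K) (κ := κ + 1) fun φ => ?_
    rw [abs_mul]
    have h1 : ‖φ‖ ≤ Real.exp ‖φ‖ := by linarith [Real.add_one_le_exp ‖φ‖]
    calc |Kbil w c M2 φ h| * |g φ| ≤ (kbound w c M2 h * ‖φ‖) * (K * Real.exp (κ * ‖φ‖)) :=
          mul_le_mul (abs_Kbil_le w c M2 φ h) (hgb φ) (abs_nonneg _) (by positivity)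
      _ ≤ (kbound w c M2 h * Real.exp ‖φ‖) * (K * Real.exp (κ * ‖φ‖)) :=
          mul_le_mul_of_nonneg_right (mul_le_mul_of_nonneg_left h1 hkb) (by positivity)
      _ = kbound w c M2 h * K * Real.exp ((κ + 1) * ‖φ‖) := by
          rw [add_mul, one_mul, Real.exp_add]
          ring
  have hI2 : Integrable (fun φ => W φ * g' φ) (volume : Measure (Cfg P j N)) := integrable_weight_mul C η w c M2 hw hM hg'c hg'b
  have hsplit : ∫ φ, F' 0 φ = (∫ φ, W φ * g' φ) - ∫ φ, W φ * (Kbil w c M2 φ h * g φ) := by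
    rw [← integral_sub hI2 hI1]
    refine integral_congr_ae (Filter.Eventually.of_forall fun φ => ?_)
    simp only [hF', zero_smul, add_zero]
    ring
  rw [hsplit] at hzero
  linarith

/-! ## §5 Second moments: the propagator -/

/-- **The covariance of `dμ_{C^η_{M²}}`**: `∫dφ e^{−½⟨φ,Kφ⟩}⟪φ(x),v⟫⟪φ(y),u⟫ = Z·C^η_{M²}(x,y)·⟪v,u⟫` (`Z = ∫dφ e^{−½⟨φ,Kφ⟩}`),
i.e. `∫dμ_{C^η_{M²}}φ_i(x)φ_k(y) = δ_{ik}C^η_{M²}(x,y)` — *"the propagators are C^η_{M²}"*. [cite: Balaban1983Higgs3, (2.26) p.431] -/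
theorem moment2 (hw : 0 < w) (hM : 0 < M2) (x y : Site P j) (v u : EuclideanSpace ℝ (Fin N)) :
    ∫ φ, weight C η w c M2 (0 : VecField P j ℝ) φ * (⟪φ x, v⟫_ℝ * ⟪φ y, u⟫_ℝ) =
      (∫ φ, weight C η w c M2 (0 : VecField P j ℝ) φ) * (G w c M2 x y * ⟪v, u⟫_ℝ) := by
  set h : Cfg P j N := gcol w c M2 x v with hh
  have hKn : 0 ≤ ‖u‖ * (1 + ‖h‖) := by positivity
  have hmain := gaussIBP C η w c M2 hw hM h (fun φ => ⟪φ y, u⟫_ℝ) (fun _ => ⟪h y, u⟫_ℝ) ?_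
    ((continuous_apply y).inner continuous_const) continuous_const (K := ‖u‖ * (1 + ‖h‖)) (κ := 1) zero_le_one ?_ ?_
  · have hlhs : (fun φ : Cfg P j N => weight C η w c M2 (0 : VecField P j ℝ) φ * (⟪φ x, v⟫_ℝ * ⟪φ y, u⟫_ℝ)) =
        fun φ => weight C η w c M2 (0 : VecField P j ℝ) φ * (Kbil w c M2 φ h * ⟪φ y, u⟫_ℝ) := by
      funext φ
      rw [hh, Kbil_gcol w c M2 hw hM]
    rw [hlhs, hmain, integral_mul_const, hh]
    unfold gcol
    rw [real_inner_smul_left, G_symm w c M2 y x]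
  · exact fun φ s => hasDerivAt_inner_transl φ h y u s
  · intro φ
    have h1 : ‖φ‖ ≤ Real.exp (1 * ‖φ‖) := by rw [one_mul]; linarith [Real.add_one_le_exp ‖φ‖]
    calc |⟪φ y, u⟫_ℝ| ≤ ‖φ y‖ * ‖u‖ := abs_real_inner_le_norm _ _
      _ ≤ ‖φ‖ * ‖u‖ := mul_le_mul_of_nonneg_right (norm_le_pi_norm φ y) (norm_nonneg _)
      _ ≤ Real.exp (1 * ‖φ‖) * (‖u‖ * (1 + ‖h‖)) := mul_le_mul h1 (by nlinarith [norm_nonneg u, norm_nonneg h]) (norm_nonneg _) (Real.exp_pos _).le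
      _ = ‖u‖ * (1 + ‖h‖) * Real.exp (1 * ‖φ‖) := by ring
  · intro φ
    have h1 : 1 ≤ Real.exp (1 * ‖φ‖) := Real.one_le_exp (by positivity)
    calc |⟪h y, u⟫_ℝ| ≤ ‖h y‖ * ‖u‖ := abs_real_inner_le_norm _ _
      _ ≤ ‖h‖ * ‖u‖ := mul_le_mul_of_nonneg_right (norm_le_pi_norm h y) (norm_nonneg _)
      _ ≤ ‖u‖ * (1 + ‖h‖) * 1 := by nlinarith [norm_nonneg u, norm_nonneg h]
      _ ≤ ‖u‖ * (1 + ‖h‖) * Real.exp (1 * ‖φ‖) := mul_le_mul_of_nonneg_left h1 hKn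

/-- `tr Q := Σ_i ⟪e_i, Qe_i⟫` over the standard orthonormal basis of `R^N` (the traces `tr q²`, `tr q(…)q(…)` of (2.26)).
[cite: Balaban1983Higgs3, (2.26) p.431] -/
def trE (Q : EuclideanSpace ℝ (Fin N) →L[ℝ] EuclideanSpace ℝ (Fin N)) : ℝ :=
  ∑ i : Fin N, ⟪EuclideanSpace.basisFun (Fin N) ℝ i, Q (EuclideanSpace.basisFun (Fin N) ℝ i)⟫_ℝ

/-- `e^{−½⟨φ,Kφ⟩}⟪φ(x),v⟫⟪φ(y),u⟫` is integrable. [cite: Balaban1983Higgs3, (2.26) p.431] -/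
theorem integrable_weight_mul_inner_inner (hw : 0 < w) (hM : 0 < M2) (x y : Site P j) (v u : EuclideanSpace ℝ (Fin N)) :
    Integrable (fun φ => weight C η w c M2 (0 : VecField P j ℝ) φ * (⟪φ x, v⟫_ℝ * ⟪φ y, u⟫_ℝ)) := by
  refine integrable_weight_mul C η w c M2 hw hM (((continuous_apply x).inner continuous_const).mul
    ((continuous_apply y).inner continuous_const)) (K := ‖v‖ * ‖u‖) (κ := 2) fun φ => ?_
  rw [abs_mul]
  have h1 : ‖φ‖ ≤ Real.exp ‖φ‖ := by linarith [Real.add_one_le_exp ‖φ‖]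
  have h2 : ‖φ‖ * ‖φ‖ ≤ Real.exp (2 * ‖φ‖) := by
    have := mul_le_mul h1 h1 (norm_nonneg _) (Real.exp_pos _).le
    rwa [← Real.exp_add, ← two_mul] at this
  calc |⟪φ x, v⟫_ℝ| * |⟪φ y, u⟫_ℝ| ≤ (‖φ x‖ * ‖v‖) * (‖φ y‖ * ‖u‖) :=
        mul_le_mul (abs_real_inner_le_norm _ _) (abs_real_inner_le_norm _ _) (abs_nonneg _) (by positivity)
    _ ≤ (‖φ‖ * ‖v‖) * (‖φ‖ * ‖u‖) :=
        mul_le_mul (mul_le_mul_of_nonneg_right (norm_le_pi_norm φ x) (norm_nonneg _))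
          (mul_le_mul_of_nonneg_right (norm_le_pi_norm φ y) (norm_nonneg _)) (by positivity) (by positivity)
    _ = ‖v‖ * ‖u‖ * (‖φ‖ * ‖φ‖) := by ring
    _ ≤ ‖v‖ * ‖u‖ * Real.exp (2 * ‖φ‖) := mul_le_mul_of_nonneg_left h2 (by positivity)

/-- **operator form of the covariance**: `∫dφ e^{−½⟨φ,Kφ⟩}⟪φ(x),Qφ(y)⟫ = Z·C^η_{M²}(x,y)·tr Q` for every operator `Q` on `R^N`
(e.g. `Q = q²`: the single-propagator terms of (2.26)). [cite: Balaban1983Higgs3, (2.26) p.431] -/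
theorem moment2_op (hw : 0 < w) (hM : 0 < M2) (x y : Site P j) (Q : EuclideanSpace ℝ (Fin N) →L[ℝ] EuclideanSpace ℝ (Fin N)) :
    ∫ φ, weight C η w c M2 (0 : VecField P j ℝ) φ * ⟪φ x, Q (φ y)⟫_ℝ =
      (∫ φ, weight C η w c M2 (0 : VecField P j ℝ) φ) * (G w c M2 x y * trE Q) := by
  set e := EuclideanSpace.basisFun (Fin N) ℝ with he
  have hexp : ∀ φ : Cfg P j N, ⟪φ x, Q (φ y)⟫_ℝ = ∑ i : Fin N, ⟪φ x, e i⟫_ℝ * ⟪φ y, (ContinuousLinearMap.adjoint Q) (e i)⟫_ℝ := by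
    intro φ
    rw [← e.sum_inner_mul_inner (φ x) (Q (φ y))]
    refine Finset.sum_congr rfl fun i _ => ?_
    rw [← ContinuousLinearMap.adjoint_inner_left, real_inner_comm (φ y)]
  have hint : ∀ i : Fin N, Integrable (fun φ => weight C η w c M2 (0 : VecField P j ℝ) φ *
      (⟪φ x, e i⟫_ℝ * ⟪φ y, (ContinuousLinearMap.adjoint Q) (e i)⟫_ℝ)) := fun i =>
    integrable_weight_mul_inner_inner C η w c M2 hw hM x y _ _
  simp_rw [hexp, Finset.mul_sum]
  rw [integral_finsetSum _ (fun i _ => hint i)]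
  simp_rw [moment2 C η w c M2 hw hM]
  rw [trE, Finset.mul_sum, Finset.mul_sum]
  refine Finset.sum_congr rfl fun i _ => ?_
  rw [← he, ContinuousLinearMap.adjoint_inner_right, real_inner_comm (e i)]

/-! ## §6 Translation invariance of the propagator: `C^η_{M²}(x,x) = C^η_{M²}(0)` -/

/-- translation of the torus `T^{(j)}` by `t`: `x ↦ x + t` (componentwise, periodically). [cite: Balaban1982Higgs1, (1.2) p.604] -/
def transl (t x : Site P j) : Site P j := fun μ => x μ + t μ

/-- `−t`. [cite: Balaban1982Higgs1, (1.2) p.604] -/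
def neg (t : Site P j) : Site P j := fun μ => -t μ

/-- translations commute with the nearest-neighbour shift: `(x+t) + e_μ = (x + e_μ) + t`. [cite: Balaban1982Higgs1, (1.2) p.604] -/
theorem transl_shift (t x : Site P j) (μ : Fin P.d) : (transl t x).shift μ = transl t (x.shift μ) := by
  funext ν
  unfold Site.shift transl
  by_cases h : ν = μ
  · subst h
    simp only [Function.update_self]
    ring
  · simp only [Function.update_of_ne h]

/-- translation by `t` as a permutation of the sites (inverse: translation by `−t`). [cite: Balaban1982Higgs1, (1.2) p.604] -/
def translEquiv (t : Site P j) : Site P j ≃ Site P j where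
  toFun := transl t
  invFun := transl (neg t)
  left_inv x := by funext μ; simp [transl, neg]
  right_inv x := by funext μ; simp [transl, neg]

/-- translation by `t` as a permutation of the bonds (`⟨x,x+e_μ⟩ ↦ ⟨x+t,x+t+e_μ⟩`). [cite: Balaban1982Higgs1, (1.4) p.604] -/
def translBond (t : Site P j) : PBond P j ≃ PBond P j where
  toFun b := ⟨transl t b.src, b.dir⟩
  invFun b := ⟨transl (neg t) b.src, b.dir⟩
  left_inv b := by
    cases b
    simp only [PBond.mk.injEq, and_true]
    funext μ; simp [transl, neg]
  right_inv b := by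
    cases b
    simp only [PBond.mk.injEq, and_true]
    funext μ; simp [transl, neg]

/-- the translated bond ends at the translated end point. [cite: Balaban1982Higgs1, (1.4) p.604] -/
theorem translBond_tgt (t : Site P j) (b : PBond P j) : (translBond t b).tgt = transl t b.tgt :=
  transl_shift t b.src b.dir

/-- **the form `⟨a,(−Δ^η+M²)a'⟩` is translation invariant.** [cite: Balaban1983Higgs3, (2.25) p.431] -/
theorem sform_transl (t : Site P j) (a a' : Site P j → ℝ) :
    sform w c M2 (a ∘ transl t) (a' ∘ transl t) = sform w c M2 a a' := by
  unfold sform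
  congr 1
  · refine Fintype.sum_equiv (translBond t) _ _ fun b => ?_
    simp only [Function.comp_apply, ← translBond_tgt]
    rfl
  · congr 1
    exact Fintype.sum_equiv (translEquiv t) _ _ fun x => rfl

/-- `δ_{x+t} = δ_x ∘ (· − t)`. [folklore] -/
private theorem single_transl (t x : Site P j) :
    (Pi.single (transl t x) (1 : ℝ) : Site P j → ℝ) = Pi.single x (1 : ℝ) ∘ transl (neg t) := by
  funext z
  simp only [Function.comp_apply, Pi.single_apply]
  have h : (z = transl t x) ↔ (transl (neg t) z = x) := by
    constructor
    · rintro rfl; funext μ; simp [transl, neg]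
    · rintro rfl; funext μ; simp [transl, neg]
  simp only [h]

/-- **`K = η^d(−Δ^η+M²)` is translation invariant: `K(x+t,y+t) = K(x,y)`.** [cite: Balaban1983Higgs3, (2.25) p.431] -/
theorem Ks_transl (t x y : Site P j) : Ks w c M2 (transl t x) (transl t y) = Ks w c M2 x y := by
  rw [Ks_apply, Ks_apply, single_transl, single_transl, sform_transl]

/-- **the propagator is translation invariant: `C^η_{M²}(x+t,y+t) = C^η_{M²}(x,y)`** (inverse of a translation-invariant
matrix). [cite: Balaban1983Higgs3, (2.26) p.431] -/
theorem G_transl (t x y : Site P j) : G w c M2 (transl t x) (transl t y) = G w c M2 x y := by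
  have hK : (Ks w c M2 : Matrix (Site P j) (Site P j) ℝ).submatrix (translEquiv t) (translEquiv t) = Ks w c M2 :=
    Matrix.ext fun x y => Ks_transl w c M2 t x y
  calc G w c M2 (transl t x) (transl t y) = ((Ks w c M2)⁻¹.submatrix (translEquiv t) (translEquiv t)) x y := rfl
    _ = ((Ks w c M2).submatrix (translEquiv t) (translEquiv t))⁻¹ x y := by rw [Matrix.inv_submatrix_equiv]
    _ = G w c M2 x y := by rw [hK]; rfl

/-- **`C^η_{M²}(x,x) = C^η_{M²}(y,y)`**: the propagator at coinciding points is a constant, the print's `C^η_{M²}(0)` of (2.26).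
[cite: Balaban1983Higgs3, (2.26) p.431] -/
theorem G_diag_const (x y : Site P j) : G w c M2 x x = G w c M2 y y := by
  have h := G_transl w c M2 (fun μ => x μ - y μ) y y
  have hx : transl (fun μ => x μ - y μ) y = x := by funext μ; simp [transl]
  rw [hx] at h
  exact h

/-- `C^η_{M²}(0)` := the value of the propagator at coinciding points (base point `x₀ = default`). [cite: Balaban1983Higgs3, (2.26) p.431] -/
def C0 : ℝ := G w c M2 (default : Site P j) default

/-- `C^η_{M²}(x,x) = C^η_{M²}(0)`. [cite: Balaban1983Higgs3, (2.26) p.431] -/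
theorem G_diag (x : Site P j) : G w c M2 x x = C0 (P := P) (j := j) w c M2 := G_diag_const w c M2 x default

end Literature.MathematicalPhysics.QuantumFieldTheory.Balaban1983to89.B3WTCovariance

end
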